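import Mathlib
import HarnessLib
import Summits.NavierStokesRegularity.NavierStokesRegularity.Theorems.PoloidalWindowDoorLrcModEntireTwistingTHPlaneOscillation
import Summits.NavierStokesRegularity.NavierStokesRegularity.Theorems.PoloidalWindowDoorLrcModEntireThreadPressure
import Summits.NavierStokesRegularity.NavierStokesRegularity.Theorems.PoloidalWindowDoorPoloidalWindowRigidityLocalFrozenLaw
import Summits.NavierStokesRegularity.NavierStokesRegularity.Theorems.PoloidalWindowDoorLrcModEntireRidgeClassConstants

/-!
# Item `LrcModEntire` (stmt-NavierStokesRegularity-20428) — THE RIDGE LAW ON EVERY WEB CURVE of the homogeneous ridge web (research cell (Q4), memo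
# `Cruxes/LrcModEntire/T2B-g14.md` §10 «`Δₕv₂|_{Γ_{t,z}} = −κ(t,z)` (ridge law on EVERY ridge, from (★) since all other terms are ridge-constant)»)

ns-k2-port-2 g6 (helper prover under the LEAD of item 20428, ns-poloidal-K2-p3 g15; `--supports stmt-NavierStokesRegularity-20428 --as helper`).
The LEAD's `…TwistingTHRidgeLaw.laplacian_two_eq_of_hotPoints` is the ridge law on the HOT web at `t = −1` (inputs: the hot-point pins).  On the homogeneous web of the
hull element delivered by `…RidgeWebClass.exists_hullLimit_ridgeWeb` the web curves `Γ_{τ,z}` at nearby times/heights are NOT hot, but the WEB FERMAT LAW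
`D(uncurry F)(τ₀, y) = D(uncurry R)(τ₀, z₀) ∘ ((τ,y) ↦ (τ,y₂))` supplies exactly the substitutes of the pins: along `Γ_{τ₀,z₀}` the value `v₂`, the time derivative
`∂ₜv₂`, the vertical derivative `∂₂v₂` take ONE value each and the horizontal gradient of `v₂` vanishes.  With the plane-constant doubled source of
`…TwistingTHPlaneOscillation.weightSource_eq_of_height_eq` (`2(1−μ)f₂ − 2(μ_t−μ_zz)v₂ − μ_zv₂² + 4μ_z∂₂v₂`, `f = ∂ₜv + (v·∇)v − Δv`) this gives:

* `residual_two_of_horizCritical` — at a point where `∇ₕv₂ = 0`: `f₂ = ∂ₜv₂ + v₂∂₂v₂ − Δv₂`;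
* `laplacian_two_eq_of_webData` — **class profile, poloidal, (TH) with a `C³` slope function `μ(s,y₂)` near the plane `{y₂ = x₂}` at time `t`, `μ(t,x₂) ≠ 1`; two points
  `x, x′` of that plane with equal `v₂`, equal `∂ₜv₂`, equal `∂₂v₂` and `∇ₕv₂ = 0` at both ⇒ `Δv₂(t,·)(x) = Δv₂(t,·)(x′)`**;
* `webData_of_fderiv_uncurry` — the four web data from the web Fermat law for `F τ = σU₂(−1+τ,·)` (`σ = ±1`) at two points of one height with the same `D(uncurry R)(τ₀,z₀)`;
* `laplacian_two_eq_of_webFermat` — the composition: **`ΔU₂(−1+τ₀,·)` takes one value at any two web points of `Γ_{τ₀,z₀}`** (hence, by the plane wave identity of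
  the (TH) column, so does `ΔₕU₂` and the transversal curvature of the ridge `Γ_{τ₀,z₀}`).

WHAT THIS IS NOT: not a claim about Navier–Stokes regularity — a structural law of the hypothetical homogeneous null ridge of the research cell (Q4) (bears_on LADDER-NS N0,
item 20428 / crux 19708; 20428/19708/27893 OPEN; (Q4) OPEN).  No summit statement is proved here.
-/

noncomputable section

-- the summit and its single sub-problem share the name (CONVENTIONS §1), as in every Theorems file
set_option linter.dupNamespace false

namespace Summit.NavierStokesRegularity.NavierStokesRegularity.Theorems.PoloidalWindowDoorLrcModEntireRidgeWebLaw

open MeasureTheory Set Function Filter Topology Metric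
open scoped RealInnerProductSpace InnerProductSpace Laplacian ContDiff
open Literature.Analysis Literature.Analysis.FluidPDE Literature.Analysis.UnboundedOperators
open Summit.NavierStokesRegularity.NavierStokesRegularity.Theorems
open Summit.NavierStokesRegularity.NavierStokesRegularity.Theorems.PoloidalWindowDoorLrcModEntireTwistingTHPlaneOscillation
open Summit.NavierStokesRegularity.NavierStokesRegularity.Theorems.PoloidalWindowDoorPoloidalWindowRigidityWindow
open Summit.NavierStokesRegularity.NavierStokesRegularity.Theorems.PoloidalWindowDoorLrcModEntireThreadPressure
open Summit.NavierStokesRegularity.NavierStokesRegularity.Theorems.PoloidalWindowDoorPoloidalWindowRigidityLocalFrozenLaw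
open Summit.NavierStokesRegularity.NavierStokesRegularity.Theorems.PoloidalWindowDoorLrcModEntireRidgeClassConstants

variable {C : ℝ} {v : ℝ → EuclideanSpace ℝ (Fin 3) → EuclideanSpace ℝ (Fin 3)}

/-- Decomposition of a vector of `ℝ³` along the standard basis. -/
theorem eq_sum_single (w : EuclideanSpace ℝ (Fin 3)) :
    w = w 0 • EuclideanSpace.single 0 (1 : ℝ) + w 1 • EuclideanSpace.single 1 (1 : ℝ) + w 2 • EuclideanSpace.single 2 (1 : ℝ) := by
  ext i; fin_cases i <;> simp

/-- **The vertical residual at a horizontally critical point.**  For a class profile and `t < 0`, at a point `x` with `∂₀v₂(t,x) = ∂₁v₂(t,x) = 0`: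
`f₂(t,x) = ∂ₜv₂(t,x) + v₂(t,x)·∂₂v₂(t,x) − Δ(v₂(t,·))(x)`, `f = ∂ₜv + (v·∇)v − Δv`. -/
theorem residual_two_of_horizCritical (hrate : HasTypeITimeDecay C v)
    (hcont : ContinuousOn (uncurry v) (Iio (0 : ℝ) ×ˢ univ))
    (hmild : ∀ s t : ℝ, s < t → t < 0 → ∀ x, v t x = heatExtension (v s) (t - s) x - oseenDuhamel 1 s v v t x)
    (hdiv : ∀ t < 0, VectorCalculus.IsDivFree (v t)) {t : ℝ} (ht : t < 0) {x : EuclideanSpace ℝ (Fin 3)}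
    (h0 : fderiv ℝ (v t) x (EuclideanSpace.single 0 1) 2 = 0) (h1 : fderiv ℝ (v t) x (EuclideanSpace.single 1 1) 2 = 0) :
    (timeDerivWithin (Iio 0) v t x + convect (v t) (v t) x - Δ (v t) x) 2 =
      deriv (fun s => v s x 2) t + v t x 2 * fderiv ℝ (v t) x (EuclideanSpace.single 2 1) 2 - (Δ (fun w => v t w 2)) x := by
  have hsm : IsSmoothSpaceTimeOn (Iio 0) v := (isTypeIAncientMild_of_class hrate hcont hmild hdiv).contDiffOn
  have htd : timeDerivWithin (Iio 0) v t x = deriv (fun s => v s x) t := by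
    rw [timeDerivWithin_apply, derivWithin_of_mem_nhds (Iio_mem_nhds ht)]
  have hct : ContDiffAt ℝ ∞ (uncurry v) (t, x) := hsm.contDiffAt isOpen_Iio (mem_Iio.2 ht) x
  have hd : DifferentiableAt ℝ (uncurry v) (t, x) := hct.differentiableAt (by simp)
  have hl : DifferentiableAt ℝ (fun s : ℝ => ((s, x) : ℝ × EuclideanSpace ℝ (Fin 3))) t :=
    differentiableAt_id.prodMk (differentiableAt_const _)
  have hline : DifferentiableAt ℝ (fun s => v s x) t := by
    have h := hd.comp t hl
    exact h
  have hslice : ContDiff ℝ ∞ (v t) := IsSmoothSpaceTimeOn.contDiff_slice (S := Iio 0) (w := v) hsm ht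
  have hslice2 : ContDiffAt ℝ 2 (v t) x := (hslice.of_le (by norm_cast)).contDiffAt
  -- the convective term: `Dv₂(x)[v(x)] = v₂ ∂₂v₂` at a horizontally critical point
  have hconv : fderiv ℝ (v t) x (v t x) 2 = v t x 2 * fderiv ℝ (v t) x (EuclideanSpace.single 2 1) 2 := by
    conv_lhs => rw [eq_sum_single (v t x)]
    simp only [map_add, map_smul, PiLp.add_apply, PiLp.smul_apply, smul_eq_mul, h0, h1, mul_zero, zero_add]
  rw [htd, convect_apply]
  simp only [PiLp.add_apply, PiLp.sub_apply]
  rw [deriv_apply_coord hline 2, hconv, laplacian_apply_coord hslice2 2]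

/-- **THE RIDGE LAW ON A WEB CURVE, pointwise form.**  Class profile, poloidal, (TH) near the plane `{y₂ = x₂}` at time `t < 0` with a `C³` slope function `μ(s, y₂)`,
`μ(t, x₂) ≠ 1`; two points `x, x′` of that plane carrying equal values `v₂`, equal time derivatives `∂ₜv₂`, equal vertical derivatives `∂₂v₂` and vanishing horizontal
gradients of `v₂` ⇒ `Δ(v₂(t,·))(x) = Δ(v₂(t,·))(x′)`. -/
theorem laplacian_two_eq_of_webData (hrate : HasTypeITimeDecay C v)
    (hcont : ContinuousOn (uncurry v) (Iio (0 : ℝ) ×ˢ univ))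
    (hmild : ∀ s t : ℝ, s < t → t < 0 → ∀ x, v t x = heatExtension (v s) (t - s) x - oseenDuhamel 1 s v v t x)
    (hdiv : ∀ t < 0, VectorCalculus.IsDivFree (v t))
    (hpol : ∀ s < 0, ∀ y, ⟪curl (v s) y, EuclideanSpace.single 2 1⟫_ℝ = 0)
    {μ : ℝ → ℝ → ℝ} (hμ : ContDiff ℝ 3 (uncurry μ)) {t : ℝ} (ht : t < 0)
    {x x' : EuclideanSpace ℝ (Fin 3)} (hxx' : x 2 = x' 2)
    (hslope : ∀ y : EuclideanSpace ℝ (Fin 3), y 2 = x 2 →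
      ∀ᶠ z in 𝓝 ((t, y) : ℝ × EuclideanSpace ℝ (Fin 3)), ∀ b : Fin 3, b ≠ 2 →
        fderiv ℝ (v z.1) z.2 (EuclideanSpace.single 2 1) b = μ z.1 (z.2 2) * fderiv ℝ (v z.1) z.2 (EuclideanSpace.single b 1) 2)
    (hμ1 : μ t (x 2) ≠ 1)
    (hval : v t x 2 = v t x' 2) (htime : deriv (fun s => v s x 2) t = deriv (fun s => v s x' 2) t)
    (hdz : fderiv ℝ (v t) x (EuclideanSpace.single 2 1) 2 = fderiv ℝ (v t) x' (EuclideanSpace.single 2 1) 2)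
    (h0 : fderiv ℝ (v t) x (EuclideanSpace.single 0 1) 2 = 0) (h1 : fderiv ℝ (v t) x (EuclideanSpace.single 1 1) 2 = 0)
    (h0' : fderiv ℝ (v t) x' (EuclideanSpace.single 0 1) 2 = 0) (h1' : fderiv ℝ (v t) x' (EuclideanSpace.single 1 1) 2 = 0) :
    (Δ (fun w => v t w 2)) x = (Δ (fun w => v t w 2)) x' := by
  have hS := weightSource_eq_of_height_eq hrate hcont hmild hdiv hpol hμ ht hxx' hslope
  rw [residual_two_of_horizCritical hrate hcont hmild hdiv ht h0 h1, residual_two_of_horizCritical hrate hcont hmild hdiv ht h0' h1',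
    ← hxx', ← hval, ← htime, ← hdz] at hS
  have hρ : (1 - μ t (x 2)) ≠ 0 := sub_ne_zero.2 (Ne.symm hμ1)
  have h2 : 2 * (1 - μ t (x 2)) * ((Δ (fun w => v t w 2)) x' - (Δ (fun w => v t w 2)) x) = 0 := by linarith
  rcases mul_eq_zero.1 h2 with h | h
  · exact absurd h (mul_ne_zero two_ne_zero hρ)
  · linarith

/-- **The web data from the web Fermat law.**  Class profile `U`, `σ = ±1`, `F τ = σU₂(−1+τ,·)`, `|τ₀| < 1/2`; at two points `p, p′` of one height with
`D(uncurry F)(τ₀, p) = A ∘ ((τ,y) ↦ (τ,y₂)) = D(uncurry F)(τ₀, p′)` (one `A`, e.g. `D(uncurry R)(τ₀,z₀)`) and `F τ₀ p = F τ₀ p′`: equal `U₂`, equal `∂ₜU₂`, equal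
`∂₂U₂`, vanishing horizontal gradients of `U₂` at time `−1+τ₀`. -/
theorem webData_of_fderiv_uncurry (hrate : HasTypeITimeDecay C v)
    (hcont : ContinuousOn (uncurry v) (Iio (0 : ℝ) ×ˢ univ))
    (hmild : ∀ s t : ℝ, s < t → t < 0 → ∀ x, v t x = heatExtension (v s) (t - s) x - oseenDuhamel 1 s v v t x)
    (hdiv : ∀ t < 0, VectorCalculus.IsDivFree (v t)) {σ : ℝ} (hσ : σ = 1 ∨ σ = -1) {τ₀ : ℝ} (hτ₀ : |τ₀| < 1 / 2)
    {p p' : EuclideanSpace ℝ (Fin 3)} {A : ℝ × ℝ →L[ℝ] ℝ}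
    (hp : fderiv ℝ (uncurry fun τ y => σ * v (-1 + τ) y 2) (τ₀, p) =
      A.comp ((ContinuousLinearMap.fst ℝ ℝ (EuclideanSpace ℝ (Fin 3))).prod
        ((EuclideanSpace.proj (2 : Fin 3)).comp (ContinuousLinearMap.snd ℝ ℝ (EuclideanSpace ℝ (Fin 3))))))
    (hp' : fderiv ℝ (uncurry fun τ y => σ * v (-1 + τ) y 2) (τ₀, p') =
      A.comp ((ContinuousLinearMap.fst ℝ ℝ (EuclideanSpace ℝ (Fin 3))).prod
        ((EuclideanSpace.proj (2 : Fin 3)).comp (ContinuousLinearMap.snd ℝ ℝ (EuclideanSpace ℝ (Fin 3))))))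
    (hval : σ * v (-1 + τ₀) p 2 = σ * v (-1 + τ₀) p' 2) :
    v (-1 + τ₀) p 2 = v (-1 + τ₀) p' 2 ∧
      deriv (fun s => v s p 2) (-1 + τ₀) = deriv (fun s => v s p' 2) (-1 + τ₀) ∧
      fderiv ℝ (v (-1 + τ₀)) p (EuclideanSpace.single 2 1) 2 = fderiv ℝ (v (-1 + τ₀)) p' (EuclideanSpace.single 2 1) 2 ∧
      fderiv ℝ (v (-1 + τ₀)) p (EuclideanSpace.single 0 1) 2 = 0 ∧ fderiv ℝ (v (-1 + τ₀)) p (EuclideanSpace.single 1 1) 2 = 0 ∧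
      fderiv ℝ (v (-1 + τ₀)) p' (EuclideanSpace.single 0 1) 2 = 0 ∧ fderiv ℝ (v (-1 + τ₀)) p' (EuclideanSpace.single 1 1) 2 = 0 := by
  have hσ0 : σ ≠ 0 := by rcases hσ with h | h <;> simp [h]
  have hσσ : σ * σ = 1 := by rcases hσ with h | h <;> simp [h]
  set G : ℝ × EuclideanSpace ℝ (Fin 3) → ℝ := uncurry fun τ y => σ * v (-1 + τ) y 2 with hG
  have ht : -1 + τ₀ < 0 := by linarith [(abs_lt.1 hτ₀).2]
  -- joint differentiability of `G` at both points
  have hGd : ∀ q : EuclideanSpace ℝ (Fin 3), DifferentiableAt ℝ G (τ₀, q) := fun q => by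
    have h := contDiffOn_uncurry_signed hrate hcont hmild hdiv σ (n := 1) (T := Ioo (-1 / 2) (1 / 2)) Subset.rfl
    exact (h.differentiableOn (by simp)).differentiableAt
      ((isOpen_Ioo.prod isOpen_univ).mem_nhds ⟨⟨by linarith [(abs_lt.1 hτ₀).1], by linarith [(abs_lt.1 hτ₀).2]⟩, mem_univ _⟩)
  -- spatial derivatives of the slice through `G`
  have hslice : ContDiff ℝ ∞ (v (-1 + τ₀)) := contDiff_slice_of_class hrate hcont hmild hdiv ht
  have hv2d : ∀ q, DifferentiableAt ℝ (fun y => v (-1 + τ₀) y 2) q := fun q =>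
    (((contDiff_piLp_apply (p := 2) (𝕜 := ℝ) (E := fun _ : Fin 3 => ℝ) (i := (2 : Fin 3))).comp hslice).differentiable (by simp)) q
  have hspace : ∀ q (h : EuclideanSpace ℝ (Fin 3)), σ * fderiv ℝ (v (-1 + τ₀)) q h 2 = fderiv ℝ G (τ₀, q) ((0 : ℝ), h) := by
    intro q h
    have hι : HasFDerivAt (fun y : EuclideanSpace ℝ (Fin 3) => ((τ₀, y) : ℝ × EuclideanSpace ℝ (Fin 3)))
        (ContinuousLinearMap.inr ℝ ℝ (EuclideanSpace ℝ (Fin 3))) q := hasFDerivAt_prodMk_right τ₀ q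
    have hc := (hGd q).hasFDerivAt.comp q hι
    have e : (G ∘ fun y : EuclideanSpace ℝ (Fin 3) => ((τ₀, y) : ℝ × EuclideanSpace ℝ (Fin 3))) = fun y => σ * v (-1 + τ₀) y 2 := by
      funext y; simp [hG]
    rw [e] at hc
    have hv : HasFDerivAt (v (-1 + τ₀)) (fderiv ℝ (v (-1 + τ₀)) q) q := ((hslice.differentiable (by simp)) q).hasFDerivAt
    have h2 : HasFDerivAt (fun y => σ * v (-1 + τ₀) y 2)
        (σ • ((EuclideanSpace.proj (𝕜 := ℝ) (2 : Fin 3)).comp (fderiv ℝ (v (-1 + τ₀)) q))) q := by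
      have h3 := ((EuclideanSpace.proj (𝕜 := ℝ) (2 : Fin 3)).hasFDerivAt.comp q hv).const_mul σ
      exact h3
    have huniq := hc.unique h2
    have happ := congrArg (fun L : EuclideanSpace ℝ (Fin 3) →L[ℝ] ℝ => L h) huniq
    simp only [ContinuousLinearMap.comp_apply, ContinuousLinearMap.inr_apply, smul_apply, smul_eq_mul] at happ
    rw [happ]; rfl
  -- time derivatives through `G`
  have htimeG : ∀ q, σ * deriv (fun s => v s q 2) (-1 + τ₀) = fderiv ℝ G (τ₀, q) ((1 : ℝ), (0 : EuclideanSpace ℝ (Fin 3))) := by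
    intro q
    have hι : HasDerivAt (fun τ : ℝ => ((τ, q) : ℝ × EuclideanSpace ℝ (Fin 3))) ((1 : ℝ), (0 : EuclideanSpace ℝ (Fin 3))) τ₀ :=
      (hasDerivAt_id τ₀).prodMk (hasDerivAt_const τ₀ q)
    have hc := (hGd q).hasFDerivAt.comp_hasDerivAt τ₀ hι
    have e : (G ∘ fun τ : ℝ => ((τ, q) : ℝ × EuclideanSpace ℝ (Fin 3))) = fun τ => σ * v (-1 + τ) q 2 := by funext τ; simp [hG]
    rw [e] at hc
    -- shift `τ = s + 1`
    have eτ : (-1 + τ₀) + 1 = τ₀ := by ring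
    have hc' : HasDerivAt (fun τ => σ * v (-1 + τ) q 2) (fderiv ℝ G (τ₀, q) ((1 : ℝ), (0 : EuclideanSpace ℝ (Fin 3)))) ((-1 + τ₀) + 1) := by
      rw [eτ]; exact hc
    have hsh := (HasDerivAt.comp_add_const (-1 + τ₀) 1 hc').const_mul σ
    have e3 : (fun s : ℝ => σ * (σ * v (-1 + (s + 1)) q 2)) = fun s => v s q 2 := by
      funext s; rw [← mul_assoc, hσσ, one_mul, show -1 + (s + 1) = s by ring]
    rw [e3] at hsh
    rw [hsh.deriv, ← mul_assoc, hσσ, one_mul]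
  -- read the values of `A`
  have hL : ∀ (a : ℝ) (h : EuclideanSpace ℝ (Fin 3)),
      (A.comp ((ContinuousLinearMap.fst ℝ ℝ (EuclideanSpace ℝ (Fin 3))).prod
        ((EuclideanSpace.proj (2 : Fin 3)).comp (ContinuousLinearMap.snd ℝ ℝ (EuclideanSpace ℝ (Fin 3)))))) (a, h) = A (a, h 2) := fun a h => by
    simp
  have hzero : ∀ b : Fin 3, b ≠ 2 →
      (A.comp ((ContinuousLinearMap.fst ℝ ℝ (EuclideanSpace ℝ (Fin 3))).prod
        ((EuclideanSpace.proj (2 : Fin 3)).comp (ContinuousLinearMap.snd ℝ ℝ (EuclideanSpace ℝ (Fin 3))))))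
          ((0 : ℝ), EuclideanSpace.single b (1 : ℝ)) = 0 := by
    intro b hb
    rw [hL]
    have e0 : (EuclideanSpace.single b (1 : ℝ) : EuclideanSpace ℝ (Fin 3)) 2 = 0 := by
      simp [hb.symm]
    rw [e0, Prod.mk_zero_zero, map_zero]
  refine ⟨?_, ?_, ?_, ?_, ?_, ?_, ?_⟩
  · exact mul_left_cancel₀ hσ0 hval
  · apply mul_left_cancel₀ hσ0
    rw [htimeG p, htimeG p', hp, hp']
  · apply mul_left_cancel₀ hσ0
    rw [hspace p, hspace p', hp, hp']
  · apply mul_left_cancel₀ hσ0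
    rw [hspace p, hp, mul_zero, hzero 0 (by decide)]
  · apply mul_left_cancel₀ hσ0
    rw [hspace p, hp, mul_zero, hzero 1 (by decide)]
  · apply mul_left_cancel₀ hσ0
    rw [hspace p', hp', mul_zero, hzero 0 (by decide)]
  · apply mul_left_cancel₀ hσ0
    rw [hspace p', hp', mul_zero, hzero 1 (by decide)]

/-- **THE RIDGE LAW ON EVERY WEB CURVE** (composition).  Class profile `U`, poloidal, (TH) near the plane `{y₂ = p₂}` at time `−1+τ₀` (`|τ₀| < 1/2`) with a `C³` slope
function `μ`, `μ(−1+τ₀, p₂) ≠ 1`; `σ = ±1`, `F τ = σU₂(−1+τ,·)`; two points `p, p′` of that plane with `F τ₀ p = F τ₀ p′` and the web Fermat law with ONE linear map `A`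
(`= D(uncurry R)(τ₀,z₀)` for two web points of `Γ_{τ₀,z₀}` delivered by `…RidgeWebClass.exists_hullLimit_ridgeWeb`) ⇒ **`ΔU₂(−1+τ₀,·)(p) = ΔU₂(−1+τ₀,·)(p′)`**. -/
theorem laplacian_two_eq_of_webFermat (hrate : HasTypeITimeDecay C v)
    (hcont : ContinuousOn (uncurry v) (Iio (0 : ℝ) ×ˢ univ))
    (hmild : ∀ s t : ℝ, s < t → t < 0 → ∀ x, v t x = heatExtension (v s) (t - s) x - oseenDuhamel 1 s v v t x)
    (hdiv : ∀ t < 0, VectorCalculus.IsDivFree (v t))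
    (hpol : ∀ s < 0, ∀ y, ⟪curl (v s) y, EuclideanSpace.single 2 1⟫_ℝ = 0)
    {μ : ℝ → ℝ → ℝ} (hμ : ContDiff ℝ 3 (uncurry μ)) {τ₀ : ℝ} (hτ₀ : |τ₀| < 1 / 2)
    {p p' : EuclideanSpace ℝ (Fin 3)} (hpp' : p 2 = p' 2)
    (hslope : ∀ y : EuclideanSpace ℝ (Fin 3), y 2 = p 2 →
      ∀ᶠ z in 𝓝 ((-1 + τ₀, y) : ℝ × EuclideanSpace ℝ (Fin 3)), ∀ b : Fin 3, b ≠ 2 →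
        fderiv ℝ (v z.1) z.2 (EuclideanSpace.single 2 1) b = μ z.1 (z.2 2) * fderiv ℝ (v z.1) z.2 (EuclideanSpace.single b 1) 2)
    (hμ1 : μ (-1 + τ₀) (p 2) ≠ 1) {σ : ℝ} (hσ : σ = 1 ∨ σ = -1) {A : ℝ × ℝ →L[ℝ] ℝ}
    (hp : fderiv ℝ (uncurry fun τ y => σ * v (-1 + τ) y 2) (τ₀, p) =
      A.comp ((ContinuousLinearMap.fst ℝ ℝ (EuclideanSpace ℝ (Fin 3))).prod
        ((EuclideanSpace.proj (2 : Fin 3)).comp (ContinuousLinearMap.snd ℝ ℝ (EuclideanSpace ℝ (Fin 3))))))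
    (hp' : fderiv ℝ (uncurry fun τ y => σ * v (-1 + τ) y 2) (τ₀, p') =
      A.comp ((ContinuousLinearMap.fst ℝ ℝ (EuclideanSpace ℝ (Fin 3))).prod
        ((EuclideanSpace.proj (2 : Fin 3)).comp (ContinuousLinearMap.snd ℝ ℝ (EuclideanSpace ℝ (Fin 3))))))
    (hval : σ * v (-1 + τ₀) p 2 = σ * v (-1 + τ₀) p' 2) :
    (Δ (fun w => v (-1 + τ₀) w 2)) p = (Δ (fun w => v (-1 + τ₀) w 2)) p' := by
  have ht : -1 + τ₀ < 0 := by linarith [(abs_lt.1 hτ₀).2]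
  obtain ⟨hv, htime, hdz, h0, h1, h0', h1'⟩ := webData_of_fderiv_uncurry hrate hcont hmild hdiv hσ hτ₀ hp hp' hval
  exact laplacian_two_eq_of_webData hrate hcont hmild hdiv hpol hμ ht hpp' hslope hμ1 hv htime hdz h0 h1 h0' h1'

end Summit.NavierStokesRegularity.NavierStokesRegularity.Theorems.PoloidalWindowDoorLrcModEntireRidgeWebLaw

end
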